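import Summits.NavierStokesRegularity.NavierStokesRegularity.Theorems.ExtremiserTransienceNearExtremalTransienceExtremiserLiouvilleConstantSpeedMultiplierIdentities
import Summits.NavierStokesRegularity.NavierStokesRegularity.Theorems.ExtremiserTransienceNearExtremalTransienceExtremiserLiouvilleConstantSpeedMultiplierExtension
import HarnessLib.Audit

/-!
# LINE «kernel_budget» (crux stmt-NavierStokesRegularity-21883) — rev 2 TYPED TARGETS of the MEAN-VALUE SIGN LAW (α)(β)(γ) and the
# far-field Caccioppoli / τ-bootstrap (P6), over the tree's multiplier API (`ExtremiserLiouville.exists_multiplierMeasure`, p-landed)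

Companion of `Lines/kernel_budget.lean` (skeleton of record, 5 stubs) and `Lines/kernel_budget_meanvalue.md` (rev 1.1).  Answer to critic
idea-crit-8 g4 V88/N96 prices: (α), (β), (γ) and P6 as SEPARATE sorried statements with Lean signatures; identity (ii) of N96 is the TREE
THEOREM `ExtremiserLiouville.multiplier_integral_normSq_sub` (`∫‖v − c‖² dμ = 2S²`, no target needed).  These four statements are
UPSTREAM TARGETS of the line's programme (they are what the representation S1 + exact sphere means give); they are NOT yet wired into the
composition (`noJetObject_of` still consumes C, A, B) — the wiring `(α)(β)(γ)+T7+S1 ⇒ C ∧ ¬JET` is the informal step (δ) of the card, whose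
one delicate point (a-priori finiteness for the absorption on slabs) is stated there.  Nothing here is proved; no summit, crux or K1b is
claimed.

Setting = the residue object WITH its multiplier package, exactly as output by `exists_multiplierMeasure_farField` (p-landed): `v` analytic,
smooth, div-free, `‖v‖ ≡ M > 0`, `‖Dv‖ ≤ B`, `D¹v, D²v ∈ L²`, extremal `|S| = κ⋆M√Z√W`, far field `c` (`‖c‖ = M`, `v − c → 0`, `v − c ∈ L⁶`),
and a finite positive Borel measure `μ`, `μ(ℝ³) ≤ κ⋆²ZW`, with the multiplier identity on smooth compactly supported solenoidal tests.
KNOWN (tree): `S²/(2M²) ≤ μ(ℝ³) ≤ κ⋆²ZW = S²/M²` (`multiplier_mass_ge`, extremality), `∫‖v−c‖²dμ = 2S²`, `∫⟪v,c⟫dμ ≤ 0`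
(`multiplier_integral_inner_farField_nonpos`), and `∫ v dμ = 0` for the JET alternative (`integral_eq_zero_of_jet`, p681118).
NEW CLAIMS (sign law): T4 mass equality `μ(ℝ³) = κ⋆²ZW` (⟺ `∫⟪v,c⟫dμ = 0` ⟺ axial force `b_ξ = 0`) for EVERY residue object (FLAT
included); T5 zero total force `∫ v dμ = 0` always; T6 tail law `s·μ(|x| > s) → 0`; T7 far-field Caccioppoli with explicit μ-feedback term;
T8 annular decay `r⁻¹∫_{r<‖x‖<2r}‖v − c‖² → 0` for EVERY residue object (= stub A's conclusion WITHOUT the JET hypothesis; `annularDecay_stubA`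
below PROVES `T8 ⇒ Sig.StubA` verbatim); T9 = LEMMA E, the multiplier identity on the decay-one test class.

## REV 2 HEADLINE — THE PAIRING ROUTE (found while paying P2/P6; supersedes S1 for T4, T5, T6, T8)

No representation formula, no Liouville theorem and no kernel constant is needed for T4/T5/T6/T8: only the Euler–Lagrange identity itself,
tested against ONE explicit family.  Fix a smooth radial `h ≥ 0` supported in `1 ≤ ‖y‖ ≤ 2`, `ψ := Δ⁻¹h < 0` (Newtonian potential; radial,
CONSTANT `= ψ(0) = −m₀`, `m₀ = (4π)⁻¹∫h/‖y‖`, on the unit ball, `= −(∫h)/(4π‖y‖)` outside `B₂`), a unit vector `e`, and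
`K := ℙ(ψ e) = ψe − ∇∂_eΔ⁻¹ψ` (smooth, solenoidal, bounded, `|DᵏK| ≲ ‖y‖^{−1−k}`; `K ≡ (2/3)ψ(0)e` on `B₁` because the Hessian of the radial
`Δ⁻¹ψ` at points of `B₁` is `(ψ(0)/3)·Id`).  Test with `K_s := K(·/s)` (admissible by T9 = lemma E).  The four terms of the identity
`S·J1(K_s) − κ⋆²M²(W·A1(K_s) + Z·C1(K_s)) = ∫⟪v, K_s⟫dμ` are then EXPLICIT:
* `A1(K_s) = ∫⟪ω, curl K_s⟫ = ∫⟪V, curl curl K_s⟫ = −s⁻²∫⟪V, (ΔK)(x/s)⟫dx = −s⁻² ∫ h(x/s) V_e(x) dx` (`div K = 0`; `ΔK = ℙ(he)` and `V = v − c`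
  is divergence-free, so the gradient part pairs to zero — boundary terms vanish because `V → 0`);
* `|J1(K_s)| ≤ (C/s)·(‖Dv‖_{L²(‖x‖>s)}‖ω‖_{L²(‖x‖>s)} + ‖ω‖²_{L²(‖x‖>s)}) = o(1/s)` (`curl K_s`, `DK_s` vanish on `B_s` and are `≤ C/s` outside);
* `C1(K_s) = −∫⟪ω, curl ΔK_s⟫`, `curl ΔK = ∇h × e` compactly supported in the annulus ⇒ `|C1(K_s)| ≤ C s^{−3/2}‖ω‖_{L²(s<‖x‖<2s)} = o(s^{−3/2})`;
* `∫⟪v, K_s⟫dμ = (2/3)ψ(0)·∫_{‖y‖<s} v_e dμ + ∫_{‖y‖≥s}⟪v, K(y/s)⟫dμ → (2/3)ψ(0)·b_e`, `b := ∫v dμ`.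
(T4) `e = ĉ := c/M`: `V_ĉ = ⟪v − c, c⟫/M = −‖V‖²/(2M) ≤ 0` pointwise (because `‖v‖ = ‖c‖ = M`), so `A1(K_s) ≥ 0` and the `s → ∞` limit of the
identity gives `−(2m₀/3)·b_ĉ = −κ⋆²M²W·lim A1(K_s) ≤ 0`, i.e. `b_ĉ ≥ 0`; the tree gives `b_ĉ = M⁻¹∫⟪v,c⟫dμ ≤ 0`
(`multiplier_integral_inner_farField_nonpos`).  Hence `b_ĉ = 0` = MASS EQUALITY (`∫⟪v,c⟫dμ = M²μ(ℝ³) − S²`).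
(T6)+(T8) with `b_ĉ = 0`, at finite `s`: `κ⋆²M²W·A1(K_s) + M∫_{‖y‖≥s} w(y/s) dμ ≤ |S·J1(K_s)| + κ⋆²M²Z|C1(K_s)| + η(s)·μ(‖y‖ ≥ s)`, where
`w := (2m₀/3) + K_ĉ ≥ 0` on all of `ℝ³` with `w ≥ 0.3125·(2m₀/3)` on `‖y‖ ≥ 4` (thin-shell superposition: for the normalised shell of radius
`t`, `6πt·w^{(t)} = 1 − (3u/4)(1+γ) − (u³/4)(1−3γ) =: f(u,γ)`, `u = t/‖y‖ ≤ 1`, `γ = cos²θ`, and `f(1,γ) = 0`, `∂_u f ≤ 0`, `f(½,γ) ≥ 0.3125`;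
`w^{(t)} ≡ 0` inside `B_t`), and `η(s) := sup_{‖y‖≥s}(C‖V‖) → 0` collects `(2m₀/3)V_ĉ + ⟪V, K(y/s)⟫`.  BOTH left terms are `≥ 0`.  Hence
(i) `M c₀ μ(‖y‖ ≥ 4s) ≤ o(1/s) + η(s)μ(‖y‖ ≥ s)`, and the iteration `t_{k+1} ≤ o(1) + ½t_k` for `t_k := 4^k s₀·μ(‖y‖ ≥ 4^k s₀)` gives
`s·μ(‖y‖ ≥ s) → 0` = T6; (ii) `κ⋆²MW/2 · s⁻²∫h(x/s)‖V‖² ≤ o(1/s)` ⇒ `∫_{s<‖x‖<2s}‖V‖² = o(s)` = T8 — for FLAT and JET alike.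
(T5) `e ⟂ ĉ`: `|A1(K_s)| ≤ s⁻²(∫h(x/s)‖V‖²)^{1/2}(∫h(x/s)dx)^{1/2} = s⁻²·o(s)^{1/2}·O(s^{3/2}) → 0` by T8, so the limit identity gives `b_e = 0`;
with T4, `b = 0` (the tree's JET-only `integral_eq_zero_of_jet` for every residue object; by the K1b seat's `residue_blowDown_stokeslet` the
blow-downs then carry no Stokeslet).
CONSEQUENCE FOR THE LINE: stub A (`Sig.StubA`) ⇐ T8 ⇐ T9 + T4 + T6 + the calculus of `K` — all M-sized; S1 (representation) is needed ONLY for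
C (FLAT, step (δ)) and B stays the load-bearing jet-killer (T8 leaves exactly the super-conical conduit, as N96 observed).  The K1b residual
of record becomes: B ∧ C, with A, T4, T5, T6, T8 in reach of the prover seat that owns `…MultiplierExtension` / `…BlowDownStokeslet`.
Why the route might fail: (E) the extension T9 to tests decaying like `‖x‖⁻¹` (the K1b seat's class is `‖x‖⁻²`: `φ = curl A`, `|A| ≲ ⟨x⟩⁻¹`);
here `K = curl(e × ∇Δ⁻¹ψ)`-type with a BOUNDED, non-decaying potential, and the truncation errors are `ρ^{−1/2}‖ω‖_{L²(>ρ)}`,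
`‖∇ω‖_{L²(>ρ)}·O(ρ^{−3/2})`, `M‖A‖_∞ρ⁻¹μ(ℝ³)`, `ρ⁻¹·(L² tails)` — all → 0, but this is the one analytic step not yet a theorem.
-/

noncomputable section

open Set Filter Topology MeasureTheory Metric Function
open scoped ENNReal NNReal Topology InnerProductSpace RealInnerProductSpace ContDiff
open Literature.Analysis.FluidPDE Literature.Analysis

namespace Summit.NavierStokesRegularity.NavierStokesRegularity.Cruxes.NearExtremalTransience.KernelBudget.SignLaw

open Summit.NavierStokesRegularity.NavierStokesRegularity.Theorems
open Summit.NavierStokesRegularity.NavierStokesRegularity.Theorems.DepletionLadder.KStar.HalfSpace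

set_option linter.dupNamespace false
set_option linter.style.longLine false

/-- The residue object with its multiplier package (hypothesis bundle; = the hypotheses + conclusions of the tree theorem
`ExtremiserLiouville.exists_multiplierMeasure_farField`, plus analyticity from K1a and `0 < M√Z√W`). -/
def IsResiduePackage (v : E3 → E3) (c : E3) (M B : ℝ) (μ : Measure E3) : Prop :=
  AnalyticOnNhd ℝ v univ ∧ ContDiff ℝ ∞ v ∧ VectorCalculus.IsDivFree v ∧ 0 < M ∧ (∀ x, ‖v x‖ = M) ∧ (∀ x, ‖fderiv ℝ v x‖ ≤ B) ∧
  (∫⁻ x, ‖iteratedFDeriv ℝ 1 v x‖ₑ ^ 2 < ⊤) ∧ (∫⁻ x, ‖iteratedFDeriv ℝ 2 v x‖ₑ ^ 2 < ⊤) ∧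
  0 < M * Real.sqrt (Zen v) * Real.sqrt (Wpa v) ∧ |Jst v| = kStar * M * Real.sqrt (Zen v) * Real.sqrt (Wpa v) ∧
  ‖c‖ = M ∧ Tendsto (fun x => v x - c) (cocompact E3) (𝓝 0) ∧ MemLp (fun x => v x - c) 6 volume ∧
  IsFiniteMeasure μ ∧ μ univ ≤ ENNReal.ofReal (kStar ^ 2 * Zen v * Wpa v) ∧
  ∀ φ : E3 → E3, ContDiff ℝ ∞ φ → HasCompactSupport φ → VectorCalculus.IsDivFree φ →
    Jst v * J1 v φ - kStar ^ 2 * M ^ 2 * (Wpa v * A1 v φ + Zen v * C1 v φ) = ∫ x, ⟪v x, φ x⟫_ℝ ∂μ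

/-- **T4 · (α) MASS EQUALITY.**  The multiplier mass is MAXIMAL: `μ(ℝ³) = κ⋆² Z W` (`= S²/M²` by extremality), equivalently
`∫⟪v, c⟫dμ = 0`, i.e. the axial component of the total force `b = ∫ v dμ` vanishes.  Source: exact sphere means of the representing kernel
(`Lines/kernel_budget_meanvalue.md` (α): `b_ξ ≥ 0` from `V_ξ = −‖V‖²/(2M) ≤ 0` and the interior Oseen mean `δ/(6πs)`; `b_ξ ≤ 0` is the tree's
`multiplier_integral_inner_farField_nonpos`).  Known for the JET alternative (tree `integral_eq_zero_of_jet` + `multiplier_integral_normSq_sub`);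
NEW for FLAT.  REV 2 PROOF ROUTE (module docstring, «pairing route» (T4)): T9 with `K_s = ℙ(ψĉ)(·/s)`, `A1(K_s) = (2M)⁻¹s⁻²∫h(x/s)‖v − c‖² ≥ 0`,
limit `s → ∞` ⇒ `b_ĉ ≥ 0`; tree ⇒ `b_ĉ ≤ 0`.  Why it might fail: only through T9 (lemma E). [folklore] -/
theorem target_massEquality (v : E3 → E3) (c : E3) (M B : ℝ) (μ : Measure E3) (h : IsResiduePackage v c M B μ) :
    μ.real univ = kStar ^ 2 * Zen v * Wpa v := by
  sorry

/-- **T5 · (α)+(γ) ZERO TOTAL FORCE.**  `b = ∫ v dμ = 0` for EVERY residue object (the tree proves it for the JET alternative only,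
`integral_eq_zero_of_jet`).  Source: (α) for the axial part; (γ) `b_h = 0` from the horizontal sphere means (odd part of the Oseen dipole).
REV 2 PROOF ROUTE: axial part = T4; horizontal part from the limit identity with `e ⟂ ĉ` and Cauchy–Schwarz against T8
(`|A1(K_s)| ≤ s⁻²(∫h(x/s)‖V‖²)^{1/2}·O(s^{3/2}) → 0`).  Why it might fail: only through T9 and T8. [folklore] -/
theorem target_zeroForce (v : E3 → E3) (c : E3) (M B : ℝ) (μ : Measure E3) (h : IsResiduePackage v c M B μ) :
    (∫ x, v x ∂μ) = 0 := by
  sorry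

/-- **T6 · (β) TAIL LAW.**  The multiplier mass beyond radius `s` is `o(1/s)`: `s · μ{‖x‖ > s} → 0`.  Source: (β) of the sign law — after
(α), the sphere-mean identity at radius `s` reads `∫_{‖y‖>s} [1/(6πs) − K_s(y)] v_ξ dμ(y) ≤ e(s) → 0` with weight `≥ 0.31/(6πs)` beyond `2s`
(numerical table in `kernel_budget_meanvalue.md`: `max K(2s)/(4/3) = 0.6875`) and `v_ξ → M`.  REV 2 PROOF ROUTE (pairing route (T6)): the
error is EXPLICIT, `e(s) = |S·J1(K_s)| + κ⋆²M²Z|C1(K_s)| = o(1/s)` from the `L²` tails of `ω, Dv` alone (no τ-bootstrap, no T7), the weight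
`w = 2m₀/3 + K_ĉ ≥ 0` with `w ≥ 0.3125·(2m₀/3)` beyond `4s` is an explicit polynomial inequality, and the iteration `t_{k+1} ≤ o(1) + t_k/2`
closes.  Why it might fail: only through T9. [folklore] -/
theorem target_tailLaw (v : E3 → E3) (c : E3) (M B : ℝ) (μ : Measure E3) (h : IsResiduePackage v c M B μ) :
    Tendsto (fun s : ℝ => s * μ.real {x : E3 | s < ‖x‖}) atTop (𝓝 0) := by
  sorry

/-- **T7 · (P6) FAR-FIELD CACCIOPPOLI with explicit multiplier feedback** (the «τ-bootstrap» in integrated form).  Testing the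
Euler–Lagrange identity with `χ²(v − c)` (admissible after the K1b seat's multiplier extension to decaying tests) gives, for balls far out,
`κ⋆²M²(W‖χ∇V‖² + Z‖χΔV‖²) ≤ cut-off terms + ½·sup‖V‖²·μ(2B) + S·(cubic τ-term)`, because `∫⟪V, v⟫ χ² dμ = ½∫χ²‖V‖²dμ` (`‖v‖ = ‖c‖ = M`)
— THIS is why μ's far-out density does not feed back uncontrollably: it enters multiplied by `sup_{2B}‖V‖² → 0`.  Since
`|τ| ≲ |∇V|·|ω| ≤ 2|∇V|²` pointwise, T7 bounds `‖τ‖_{L¹(B)}` by the right-hand side.  Why it might fail: the cubic term `S∫τ:∇(χ²V)` must be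
absorbed using far-out smallness of `∇V` in a scale-invariant norm (`‖∇V‖_{L³(2B)} ≤ ‖∇V‖₂^{2/3}‖∇V‖_∞^{1/3} → 0` is the intended route).
[folklore] -/
theorem target_farCaccioppoli (v : E3 → E3) (c : E3) (M B : ℝ) (μ : Measure E3) (h : IsResiduePackage v c M B μ) :
    ∃ C R₀ : ℝ, 0 < R₀ ∧ ∀ (x₀ : E3) (R : ℝ), R₀ ≤ R → 4 * R ≤ ‖x₀‖ →
      ∫ x in ball x₀ R, ‖fderiv ℝ v x‖ ^ 2 ≤
        C * (R⁻¹ ^ 2 * ∫ x in ball x₀ (2 * R), ‖v x - c‖ ^ 2 + sSup ((fun x => ‖v x - c‖ ^ 2) '' ball x₀ (2 * R)) * μ.real (ball x₀ (2 * R))) := by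
  sorry

/-- **T8 · ANNULAR DECAY for every residue object** (stub A's conclusion WITHOUT the JET hypothesis): `r⁻¹∫_{r<‖x‖<2r}‖v − c‖² → 0`.
REV 2 PROOF ROUTE (pairing route (ii)): with `b_ĉ = 0` (T4) the finite-`s` identity bounds `κ⋆²MW/2·s⁻²∫h(x/s)‖v − c‖²` by
`o(1/s) + η(s)μ(‖y‖ ≥ s) = o(1/s)` (T6).  `annularDecay_stubA` below derives the skeleton's `Sig.StubA` from T8 (PROVED).  Why it might
fail: only through T9. [folklore] -/
theorem target_annularDecay (v : E3 → E3) (c : E3) (M B : ℝ) (μ : Measure E3) (h : IsResiduePackage v c M B μ) :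
    Tendsto (fun r : ℝ => r⁻¹ * ∫ x in {x : E3 | r < ‖x‖ ∧ ‖x‖ < 2 * r}, ‖v x - c‖ ^ 2) atTop (𝓝 0) := by
  sorry

/-! ## Lemma E PROVED (rev 2.1): the multiplier identity on the bounded-potential class — port of the tree's
`multiplierIdentity_curl_of_decay` with GRADED truncation envelopes (identical text in LINE g7-3 `Lines/l2_budget.lean`; crux workfiles are
not importable, hence the copy). -/

section LemmaE
open Summit.NavierStokesRegularity.NavierStokesRegularity.Theorems.ExtremiserLiouville
open Summit.NavierStokesRegularity.NavierStokesRegularity.Theorems.DepletionLadder.KStar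
open Summit.NavierStokesRegularity.NavierStokesRegularity.Theorems.RungReynoldsOne.WeightedSlice

variable {A v : E3 → E3}

/-- GRADED truncation envelopes on the bounded-potential class: if `‖A‖ ≤ C` and `‖DᵏA(x)‖ ≤ C(1+‖x‖)^{-k}` (`k = 1,2,3`), then
`‖Dᵏ(χ_ρ A)(x)‖ ≤ 8cC·(1+‖x‖)^{-k}` for `k ≤ 3`, uniformly in `ρ ≥ 1` (Leibniz + `‖Dⁱχ_ρ‖ ≤ c(1+‖x‖)^{-i}`; every term has total
weight exactly `k`).  Variant of the tree's `norm_iteratedFDeriv_cutoff_smul_le` (class `‖A‖ ≲ (1+‖x‖)⁻¹`, `‖DᵏA‖ ≲ (1+‖x‖)⁻²`). [folklore] -/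
theorem norm_iteratedFDeriv_cutoff_smul_le_of_bounded (hA : ContDiff ℝ ∞ A) {C : ℝ}
    (hA0 : ∀ x, ‖A x‖ ≤ C)
    (hAk : ∀ k : ℕ, 1 ≤ k → k ≤ 3 → ∀ x, ‖iteratedFDeriv ℝ k A x‖ ≤ C * ((1 + ‖x‖) ^ k)⁻¹)
    {c : ℝ} (hc1 : 1 ≤ c)
    (hc : ∀ ρ : ℝ, 1 ≤ ρ → ∀ i : ℕ, i ≤ 3 → ∀ x : E3, ‖iteratedFDeriv ℝ i (cutoff (E := E3) ρ) x‖ ≤ c * ((1 + ‖x‖) ^ i)⁻¹)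
    {ρ : ℝ} (hρ : 1 ≤ ρ) {k : ℕ} (hk3 : k ≤ 3) (x : E3) :
    ‖iteratedFDeriv ℝ k (fun y => cutoff ρ y • A y) x‖ ≤ 8 * c * C * ((1 + ‖x‖) ^ k)⁻¹ := by
  have hC0 : 0 ≤ C := (norm_nonneg _).trans (hA0 0)
  have hc0 : 0 < c := by linarith
  have ht : 1 ≤ 1 + ‖x‖ := by linarith [norm_nonneg x]
  set t : ℝ := 1 + ‖x‖ with htdef
  have ht0 : 0 < t := by positivity
  have hAj : ∀ j : ℕ, j ≤ 3 → ‖iteratedFDeriv ℝ j A x‖ ≤ C * (t ^ j)⁻¹ := by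
    intro j hj
    rcases Nat.eq_zero_or_pos j with h0 | hpos
    · subst h0
      rw [norm_iteratedFDeriv_zero, pow_zero, inv_one, mul_one]
      exact hA0 x
    · exact hAk j hpos hj x
  have hle := norm_iteratedFDeriv_smul_le (contDiff_cutoff ρ : ContDiff ℝ ∞ (cutoff (E := E3) ρ)) hA x (n := k)
    (by exact_mod_cast le_top)
  refine hle.trans ?_
  have hterm : ∀ i ∈ Finset.range (k + 1),
      (k.choose i : ℝ) * ‖iteratedFDeriv ℝ i (cutoff ρ) x‖ * ‖iteratedFDeriv ℝ (k - i) A x‖ ≤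
        (k.choose i : ℝ) * (c * C * (t ^ k)⁻¹) := by
    intro i hi
    have hik : i ≤ k := Nat.lt_succ_iff.1 (Finset.mem_range.1 hi)
    have hi3 : i ≤ 3 := hik.trans hk3
    have h1 := hc ρ hρ i hi3 x
    have h2 := hAj (k - i) (by omega)
    have h3 : (t ^ i)⁻¹ * (t ^ (k - i))⁻¹ = (t ^ k)⁻¹ := by
      rw [← mul_inv, ← pow_add, Nat.add_sub_cancel' hik]
    rw [mul_assoc]
    refine mul_le_mul_of_nonneg_left ?_ (by positivity)
    calc ‖iteratedFDeriv ℝ i (cutoff ρ) x‖ * ‖iteratedFDeriv ℝ (k - i) A x‖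
        ≤ (c * (t ^ i)⁻¹) * (C * (t ^ (k - i))⁻¹) :=
          mul_le_mul h1 h2 (norm_nonneg _) (by positivity)
      _ = c * C * ((t ^ i)⁻¹ * (t ^ (k - i))⁻¹) := by ring
      _ = c * C * (t ^ k)⁻¹ := by rw [h3]
  refine (Finset.sum_le_sum hterm).trans ?_
  rw [← Finset.sum_mul]
  have hsum : ∑ i ∈ Finset.range (k + 1), (k.choose i : ℝ) = 2 ^ k := by
    have h := Nat.sum_range_choose k
    exact_mod_cast h
  rw [hsum]
  have h2k : (2 : ℝ) ^ k ≤ 8 := by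
    interval_cases k <;> norm_num
  have : 0 ≤ c * C * (t ^ k)⁻¹ := by positivity
  nlinarith [h2k, this]

/-- **The multiplier identity for solenoidal test fields `φ = curl A` with BOUNDED potential**: `v` smooth, `‖v‖ ≡ M`, `D¹v, D²v ∈ L²`,
`μ` finite with the multiplier identity on smooth compactly supported divergence-free tests; `A ∈ C^∞` with `‖A‖ ≤ C` and
`‖DᵏA(x)‖ ≤ C(1+‖x‖)^{-k}` (`k = 1,2,3`).  Then `S·J₁(curl A) − κ⋆²M²(W a₁(curl A) + Z c₁(curl A)) = ∫⟪v, curl A⟫dμ`.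
Proof = the tree's `multiplierIdentity_curl_of_decay` verbatim (solenoidal truncations `curl(χ_ρ A)`, dominated convergence in the four
integrals) with the graded envelopes above: order 1 bounded (test field bounded against the finite `μ`), orders 2, 3 below `K(1+‖x‖)⁻²`
(square integrable; `curl`, `D`, `D curl` of the truncations against `ω, Dv, ∇ω ∈ L²`). [folklore] -/
theorem multiplierIdentity_curl_of_boundedPotential (hv : ContDiff ℝ ∞ v) {M : ℝ} (hM : ∀ x, ‖v x‖ = M)
    (h1 : ∫⁻ x, ‖iteratedFDeriv ℝ 1 v x‖ₑ ^ 2 < ⊤) (h2 : ∫⁻ x, ‖iteratedFDeriv ℝ 2 v x‖ₑ ^ 2 < ⊤)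
    (μ : Measure E3) [IsFiniteMeasure μ]
    (hμ : ∀ φ : E3 → E3, ContDiff ℝ ∞ φ → HasCompactSupport φ → VectorCalculus.IsDivFree φ →
      Jst v * J1 v φ - kStar ^ 2 * M ^ 2 * (Wpa v * A1 v φ + Zen v * C1 v φ) = ∫ x, ⟪v x, φ x⟫_ℝ ∂μ)
    (hA : ContDiff ℝ ∞ A) {C : ℝ} (hA0 : ∀ x, ‖A x‖ ≤ C)
    (hAk : ∀ k : ℕ, 1 ≤ k → k ≤ 3 → ∀ x, ‖iteratedFDeriv ℝ k A x‖ ≤ C * ((1 + ‖x‖) ^ k)⁻¹) :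
    Jst v * J1 v (curl A) - kStar ^ 2 * M ^ 2 * (Wpa v * A1 v (curl A) + Zen v * C1 v (curl A)) =
      ∫ x, ⟪v x, curl A x⟫_ℝ ∂μ := by
  obtain ⟨c, hc1, hc⟩ := exists_norm_iteratedFDeriv_cutoff_le
  have hC0 : 0 ≤ C := (norm_nonneg _).trans (hA0 0)
  set κ : ℝ := ‖curlCLM‖ with hκ
  have hκ0 : 0 ≤ κ := by rw [hκ]; exact norm_nonneg curlCLM
  set K : ℝ := 8 * c * C with hK
  have hK0 : 0 ≤ K := by positivity
  set B₁ : ℝ := (1 + κ) ^ 2 * K with hB₁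
  have hB₁0 : 0 ≤ B₁ := by positivity
  have hκB : κ * K ≤ B₁ := by rw [hB₁]; nlinarith [hκ0, hK0]
  have hκ2B : κ * (κ * K) ≤ B₁ := by rw [hB₁]; nlinarith [hκ0, hK0]
  -- the envelope
  set E : E3 → ℝ := fun x => ((1 + ‖x‖) ^ 2)⁻¹ with hE
  have hE0 : ∀ x, 0 ≤ E x := fun x => by positivity
  have hE1 : ∀ x, E x ≤ 1 := fun x => by
    rw [hE]; exact inv_le_one_of_one_le₀ (one_le_pow₀ (by linarith [norm_nonneg x]))
  have hEi : Integrable (fun x => E x ^ 2) volume := integrable_inv_one_add_norm_sq_sq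
  -- the truncations
  set T : ℕ → E3 → E3 := fun n y => cutoff ((n : ℝ) + 1) y • A y with hT
  set φ : ℕ → E3 → E3 := fun n => curl (T n) with hφ
  have hρ1 : ∀ n : ℕ, (1 : ℝ) ≤ (n : ℝ) + 1 := fun n => by simp
  have hρ0 : ∀ n : ℕ, (0 : ℝ) < (n : ℝ) + 1 := fun n => by positivity
  have hTs : ∀ n, ContDiff ℝ ∞ (T n) := fun n => (contDiff_cutoff _).smul hA
  have hTc : ∀ n, HasCompactSupport (T n) := fun n => (hasCompactSupport_cutoff (hρ0 n)).smul_right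
  have hφs : ∀ n, ContDiff ℝ ∞ (φ n) := fun n => contDiff_curl (n := ⊤) (by exact_mod_cast hTs n)
  have hφc : ∀ n, HasCompactSupport (φ n) := fun n => hasCompactSupport_curl (hTc n)
  have hφdiv : ∀ n, VectorCalculus.IsDivFree (φ n) := fun n x =>
    divergence_curl_eq_zero_holds (T n) ((hTs n).of_le (by norm_cast)) x
  have hid : ∀ n, Jst v * J1 v (φ n) - kStar ^ 2 * M ^ 2 * (Wpa v * A1 v (φ n) + Zen v * C1 v (φ n)) =
      ∫ x, ⟪v x, φ n x⟫_ℝ ∂μ := fun n => hμ (φ n) (hφs n) (hφc n) (hφdiv n)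
  -- envelopes of the truncations
  have henvk : ∀ n, ∀ k : ℕ, k ≤ 3 → ∀ x, ‖iteratedFDeriv ℝ k (T n) x‖ ≤ K * ((1 + ‖x‖) ^ k)⁻¹ :=
    fun n k hk3 x => norm_iteratedFDeriv_cutoff_smul_le_of_bounded hA hA0 hAk hc1 hc (hρ1 n) hk3 x
  have ht1 : ∀ x : E3, 1 ≤ 1 + ‖x‖ := fun x => by linarith [norm_nonneg x]
  -- graded envelopes ⇒ the tree's shapes: order 1 bounded, orders 2 and 3 below `K·E`
  have henv1 : ∀ n x, ‖iteratedFDeriv ℝ 1 (T n) x‖ ≤ K := fun n x => by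
    refine (henvk n 1 (by norm_num) x).trans ?_
    have : ((1 + ‖x‖) ^ 1)⁻¹ ≤ 1 := inv_le_one_of_one_le₀ (by rw [pow_one]; exact ht1 x)
    exact mul_le_of_le_one_right hK0 this
  have henv : ∀ n, ∀ k : ℕ, 2 ≤ k → k ≤ 3 → ∀ x, ‖iteratedFDeriv ℝ k (T n) x‖ ≤ K * E x := fun n k hk2 hk3 x => by
    refine (henvk n k hk3 x).trans (mul_le_mul_of_nonneg_left ?_ hK0)
    rw [hE]
    exact inv_pow_le_inv_sq (ht1 x) hk2
  have hb0 : ∀ n x, ‖φ n x‖ ≤ B₁ := fun n x => by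
    have h := norm_iteratedFDeriv_curl_le (hTs n) 0 x
    rw [norm_iteratedFDeriv_zero] at h
    calc ‖φ n x‖ ≤ κ * ‖iteratedFDeriv ℝ 1 (T n) x‖ := h
      _ ≤ κ * K := mul_le_mul_of_nonneg_left (henv1 n x) hκ0
      _ ≤ B₁ := hκB
  have hb1 : ∀ n x, ‖fderiv ℝ (φ n) x‖ ≤ B₁ * E x := fun n x => by
    have h := norm_iteratedFDeriv_curl_le (hTs n) 1 x
    rw [← norm_fderiv_eq_norm_iteratedFDeriv_one] at h
    calc ‖fderiv ℝ (φ n) x‖ ≤ κ * ‖iteratedFDeriv ℝ 2 (T n) x‖ := h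
      _ ≤ κ * (K * E x) := mul_le_mul_of_nonneg_left (henv n 2 le_rfl (by norm_num) x) hκ0
      _ = (κ * K) * E x := by ring
      _ ≤ B₁ * E x := mul_le_mul_of_nonneg_right hκB (hE0 x)
  have hb2 : ∀ n x, ‖curl (φ n) x‖ ≤ B₁ * E x := fun n x => by
    have h := norm_iteratedFDeriv_curl_le (hφs n) 0 x
    rw [norm_iteratedFDeriv_zero] at h
    have h' := norm_iteratedFDeriv_curl_le (hTs n) 1 x
    calc ‖curl (φ n) x‖ ≤ κ * ‖iteratedFDeriv ℝ 1 (φ n) x‖ := h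
      _ ≤ κ * (κ * ‖iteratedFDeriv ℝ 2 (T n) x‖) := mul_le_mul_of_nonneg_left h' hκ0
      _ ≤ κ * (κ * (K * E x)) :=
          mul_le_mul_of_nonneg_left (mul_le_mul_of_nonneg_left (henv n 2 le_rfl (by norm_num) x) hκ0) hκ0
      _ = (κ * (κ * K)) * E x := by ring
      _ ≤ B₁ * E x := mul_le_mul_of_nonneg_right hκ2B (hE0 x)
  have hb3 : ∀ n x, ‖fderiv ℝ (curl (φ n)) x‖ ≤ B₁ * E x := fun n x => by
    have h := norm_iteratedFDeriv_curl_le (hφs n) 1 x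
    rw [← norm_fderiv_eq_norm_iteratedFDeriv_one] at h
    have h' := norm_iteratedFDeriv_curl_le (hTs n) 2 x
    calc ‖fderiv ℝ (curl (φ n)) x‖ ≤ κ * ‖iteratedFDeriv ℝ 2 (φ n) x‖ := h
      _ ≤ κ * (κ * ‖iteratedFDeriv ℝ 3 (T n) x‖) := mul_le_mul_of_nonneg_left h' hκ0
      _ ≤ κ * (κ * (K * E x)) :=
          mul_le_mul_of_nonneg_left (mul_le_mul_of_nonneg_left (henv n 3 (by norm_num) le_rfl x) hκ0) hκ0
      _ = (κ * (κ * K)) * E x := by ring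
      _ ≤ B₁ * E x := mul_le_mul_of_nonneg_right hκ2B (hE0 x)
  -- local agreement: eventually in `n`, `φ n`, `curl (φ n)`, `D(φ n)`, `D curl(φ n)` at `x` are those of `curl A`
  have hloc : ∀ x : E3, ∀ᶠ n : ℕ in atTop, φ n x = curl A x ∧ curl (φ n) x = curl (curl A) x ∧
      fderiv ℝ (φ n) x = fderiv ℝ (curl A) x ∧ fderiv ℝ (curl (φ n)) x = fderiv ℝ (curl (curl A)) x := by
    intro x
    filter_upwards [tendsto_natCast_atTop_atTop.eventually_gt_atTop ‖x‖] with n hn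
    set U : Set E3 := ball (0 : E3) ((n : ℝ) + 1) with hU
    have hUo : IsOpen U := isOpen_ball
    have hxU : x ∈ U := by rw [hU, mem_ball_zero_iff]; linarith
    have hTA : EqOn (T n) A U := fun y hy => by
      have hy' : ‖y‖ ≤ (n : ℝ) + 1 := (mem_ball_zero_iff.1 hy).le
      show cutoff ((n : ℝ) + 1) y • A y = A y
      rw [cutoff_eq_one (hρ0 n) hy', one_smul]
    obtain ⟨-, hφA⟩ := eqOn_fderiv_curl_of_isOpen hUo hTA
    obtain ⟨hDφ, hcφ⟩ := eqOn_fderiv_curl_of_isOpen hUo hφA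
    obtain ⟨hDcφ, -⟩ := eqOn_fderiv_curl_of_isOpen hUo hcφ
    exact ⟨hφA hxU, hcφ hxU, hDφ hxU, hDcφ hxU⟩
  -- integrability of the three global densities of `v`
  have IZ : Integrable (fun x => ‖curl v x‖ ^ 2) volume := (integrable_norm_curl_sq (hv.of_le (by norm_cast)) h1).1
  have IW : Integrable (fun x => frobeniusNormSq (fderiv ℝ (curl v) x)) volume :=
    (integrable_frobeniusNormSq_fderiv_curl (hv.of_le (by norm_cast)) h2).1
  have ID : Integrable (fun x => ‖fderiv ℝ v x‖ ^ 2) volume := by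
    have h1' : ∫⁻ x, ‖fderiv ℝ v x‖ₑ ^ 2 < ⊤ := by
      refine lt_of_le_of_lt (le_of_eq (lintegral_congr fun x => ?_)) h1
      rw [← ofReal_norm, ← ofReal_norm, norm_iteratedFDeriv_one]
    exact integrable_sq_norm_of_lintegral_lt_top (hv.continuous_fderiv (by simp)) h1'
  -- continuity facts
  have hcv : Continuous (curl v) := continuous_curl (hv.of_le (by norm_cast))
  have hDv : Continuous (fderiv ℝ v) := hv.continuous_fderiv (by simp)
  have hDcv : Continuous (fderiv ℝ (curl v)) :=
    (contDiff_curl (n := ⊤) (by exact_mod_cast hv)).continuous_fderiv (by simp)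
  have hcφn : ∀ n, Continuous (curl (φ n)) := fun n => continuous_curl ((hφs n).of_le (by norm_cast))
  have hDφn : ∀ n, Continuous (fderiv ℝ (φ n)) := fun n => (hφs n).continuous_fderiv (by simp)
  have hDcφn : ∀ n, Continuous (fderiv ℝ (curl (φ n))) := fun n =>
    (contDiff_curl (n := ⊤) (by exact_mod_cast hφs n)).continuous_fderiv (by simp)
  -- (L1) the `J₁` integrals
  have LJ : Tendsto (fun n => J1 v (φ n)) atTop (𝓝 (J1 v (curl A))) := by
    unfold J1
    refine tendsto_integral_of_dominated_convergence (fun x => B₁ * (‖fderiv ℝ v x‖ ^ 2 + 2 * ‖curl v x‖ ^ 2))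
      (fun n => ?_) ((ID.add (IZ.const_mul 2)).const_mul B₁) (fun n => Eventually.of_forall fun x => ?_) ?_
    · exact ((((hcφn n).inner (hDv.clm_apply hcv)).add (hcv.inner ((hDφn n).clm_apply hcv))).add
        (hcv.inner (hDv.clm_apply (hcφn n)))).aestronglyMeasurable
    · set a := ‖fderiv ℝ v x‖ with ha_def
      set b := ‖curl v x‖ with hb_def
      have ha : 0 ≤ a := norm_nonneg _
      have hb : 0 ≤ b := norm_nonneg _
      have hBE : B₁ * E x ≤ B₁ := by nlinarith [hE1 x, hB₁0]
      have hcφ : ‖curl (φ n) x‖ ≤ B₁ := (hb2 n x).trans hBE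
      have hDφ : ‖fderiv ℝ (φ n) x‖ ≤ B₁ := (hb1 n x).trans hBE
      rw [Real.norm_eq_abs]
      have t1 : |⟪curl (φ n) x, fderiv ℝ v x (curl v x)⟫| ≤ B₁ * (a * b) := by
        refine (abs_real_inner_le_norm _ _).trans ?_
        exact mul_le_mul hcφ ((fderiv ℝ v x).le_opNorm _) (norm_nonneg _) hB₁0
      have t2 : |⟪curl v x, fderiv ℝ (φ n) x (curl v x)⟫| ≤ B₁ * (b * b) := by
        refine (abs_real_inner_le_norm _ _).trans ?_
        calc ‖curl v x‖ * ‖fderiv ℝ (φ n) x (curl v x)‖ ≤ b * (B₁ * b) :=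
              mul_le_mul_of_nonneg_left (((fderiv ℝ (φ n) x).le_opNorm _).trans (mul_le_mul_of_nonneg_right hDφ hb)) hb
          _ = B₁ * (b * b) := by ring
      have t3 : |⟪curl v x, fderiv ℝ v x (curl (φ n) x)⟫| ≤ B₁ * (a * b) := by
        refine (abs_real_inner_le_norm _ _).trans ?_
        calc ‖curl v x‖ * ‖fderiv ℝ v x (curl (φ n) x)‖ ≤ b * (a * B₁) :=
              mul_le_mul_of_nonneg_left (((fderiv ℝ v x).le_opNorm _).trans (mul_le_mul_of_nonneg_left hcφ ha)) hb
          _ = B₁ * (a * b) := by ring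
      have hsum := (abs_add_le _ _).trans (add_le_add ((abs_add_le _ _).trans (add_le_add t1 t2)) t3)
      have hab : 2 * (a * b) + b * b ≤ a ^ 2 + 2 * b ^ 2 := by nlinarith [two_mul_le_add_sq a b]
      calc |⟪curl (φ n) x, fderiv ℝ v x (curl v x)⟫ + ⟪curl v x, fderiv ℝ (φ n) x (curl v x)⟫ +
            ⟪curl v x, fderiv ℝ v x (curl (φ n) x)⟫|
          ≤ B₁ * (a * b) + B₁ * (b * b) + B₁ * (a * b) := hsum
        _ = B₁ * (2 * (a * b) + b * b) := by ring
        _ ≤ B₁ * (a ^ 2 + 2 * b ^ 2) := mul_le_mul_of_nonneg_left hab hB₁0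
    · refine Eventually.of_forall fun x => tendsto_const_nhds.congr' ?_
      filter_upwards [hloc x] with n hn
      rw [hn.2.1, hn.2.2.1]
  -- (L2) the `a₁` integrals
  have LA : Tendsto (fun n => A1 v (φ n)) atTop (𝓝 (A1 v (curl A))) := by
    unfold A1
    refine tendsto_integral_of_dominated_convergence (fun x => (‖curl v x‖ ^ 2 + (B₁ * E x) ^ 2) / 2)
      (fun n => ?_) ((IZ.add ((hEi.const_mul (B₁ ^ 2)).congr (Eventually.of_forall fun x => by ring))).div_const 2)
      (fun n => Eventually.of_forall fun x => ?_) ?_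
    · exact (hcv.inner (hcφn n)).aestronglyMeasurable
    · rw [Real.norm_eq_abs]
      refine (abs_real_inner_le_norm _ _).trans ?_
      have h := hb2 n x
      nlinarith [sq_nonneg (‖curl v x‖ - B₁ * E x), norm_nonneg (curl v x), norm_nonneg (curl (φ n) x)]
    · refine Eventually.of_forall fun x => tendsto_const_nhds.congr' ?_
      filter_upwards [hloc x] with n hn
      rw [hn.2.1]
  -- (L3) the `c₁` integrals
  have LC : Tendsto (fun n => C1 v (φ n)) atTop (𝓝 (C1 v (curl A))) := by
    unfold C1
    refine tendsto_integral_of_dominated_convergence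
      (fun x => 1 / 2 * frobeniusNormSq (fderiv ℝ (curl v) x) + 1 / (2 * 1) * (3 * (B₁ * E x) ^ 2))
      (fun n => ?_) ((IW.const_mul _).add (((hEi.const_mul (3 * B₁ ^ 2)).congr
        (Eventually.of_forall fun x => by ring)).const_mul _))
      (fun n => Eventually.of_forall fun x => ?_) ?_
    · exact (continuous_finsetSum _ fun i _ =>
        (hDcv.clm_apply continuous_const).inner ((hDcφn n).clm_apply continuous_const)).aestronglyMeasurable
    · rw [Real.norm_eq_abs]
      refine (sum_inner_le_frobeniusNormSq (fderiv ℝ (curl v) x) (fderiv ℝ (curl (φ n)) x) one_pos).trans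
        (add_le_add le_rfl (mul_le_mul_of_nonneg_left ?_ (by norm_num)))
      refine (BradshawTsai2017.frobeniusNormSq_le_three_mul_norm_sq _).trans ?_
      have h := hb3 n x
      have h0 : 0 ≤ ‖fderiv ℝ (curl (φ n)) x‖ := norm_nonneg _
      nlinarith [h, h0]
    · refine Eventually.of_forall fun x => tendsto_const_nhds.congr' ?_
      filter_upwards [hloc x] with n hn
      rw [hn.2.2.2]
  -- (L4) the multiplier side
  have Lμ : Tendsto (fun n => ∫ x, ⟪v x, φ n x⟫_ℝ ∂μ) atTop (𝓝 (∫ x, ⟪v x, curl A x⟫_ℝ ∂μ)) := by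
    refine tendsto_integral_of_dominated_convergence (fun _ => M * B₁)
      (fun n => ?_) (integrable_const _) (fun n => Eventually.of_forall fun x => ?_) ?_
    · exact (hv.continuous.inner (hφs n).continuous).aestronglyMeasurable
    · rw [Real.norm_eq_abs]
      refine (abs_real_inner_le_norm _ _).trans ?_
      rw [hM x]
      exact mul_le_mul_of_nonneg_left (hb0 n x) (by rw [← hM x]; exact norm_nonneg _)
    · refine Eventually.of_forall fun x => tendsto_const_nhds.congr' ?_
      filter_upwards [hloc x] with n hn
      rw [hn.1]
  -- pass to the limit in the identity
  have Llhs : Tendsto (fun n => Jst v * J1 v (φ n) - kStar ^ 2 * M ^ 2 * (Wpa v * A1 v (φ n) + Zen v * C1 v (φ n)))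
      atTop (𝓝 (Jst v * J1 v (curl A) - kStar ^ 2 * M ^ 2 * (Wpa v * A1 v (curl A) + Zen v * C1 v (curl A)))) :=
    (LJ.const_mul _).sub (((LA.const_mul _).add (LC.const_mul _)).const_mul _)
  have e : (fun n => Jst v * J1 v (φ n) - kStar ^ 2 * M ^ 2 * (Wpa v * A1 v (φ n) + Zen v * C1 v (φ n))) =
      fun n => ∫ x, ⟪v x, φ n x⟫_ℝ ∂μ := funext hid
  rw [e] at Llhs
  exact tendsto_nhds_unique Llhs Lμ

end LemmaE

/-- **T9 · LEMMA E — PROVED (rev 2.1, by `multiplierIdentity_curl_of_boundedPotential` above) — the multiplier identity on the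
DECAY-ONE test class** (stated in the style of the K1b seat's
`ExtremiserLiouville.multiplierIdentity_curl_of_decay`, one order slower): the Euler–Lagrange identity holds for `φ = curl A` whenever the
smooth potential `A` is BOUNDED with `‖DᵏA(x)‖ ≤ C(1+‖x‖)^{−k}`, `k = 1,2,3` (so `φ = O(‖x‖⁻¹)`, `Dφ = O(‖x‖⁻²)`, `D curl φ = O(‖x‖⁻³)`).  The
pairing route's fields are of this form: `K = ℙ(ψe) = curl(e × ∇Ψ)`, `ΔΨ = ψ` radial, `∇Ψ` bounded with `DᵏΨ' = O(r^{−k})`.  Route: the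
truncations `curl(χ_ρ A)` of `…TruncationEnvelopes` and dominated convergence `ρ → ∞`; the error terms are
`≲ ρ^{−1/2}‖ω‖_{L²(‖x‖>ρ)}` (A1), `≲ ρ^{−3/2}‖∇ω‖_{L²(‖x‖>ρ)}·ρ^{0}` (C1), `≲ ρ⁻¹(‖Dv‖₂ + ‖ω‖₂)‖ω‖_{L²(‖x‖>ρ)}` (J1) and
`≲ M(Cρ⁻¹μ(ℝ³) + sup_{‖x‖>ρ}‖φ‖·μ{‖x‖ > ρ})` (μ-term) — all `→ 0`, but with envelopes one order weaker than the landed lemma's, so the four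
integrals converge absolutely only just (`curl φ ∈ L²`, `D curl φ ∈ L²`, `φ` bounded against the finite `μ`).  Why it might fail: only if
one of the four dominated-convergence steps needs the faster envelope (checked above at the level of exponents: it does not). [folklore] -/
theorem target_multiplierIdentity_decayOne (v : E3 → E3) (c : E3) (M B : ℝ) (μ : Measure E3) (h : IsResiduePackage v c M B μ)
    (A : E3 → E3) (hA : ContDiff ℝ ∞ A) (C : ℝ) (hA0 : ∀ x, ‖A x‖ ≤ C)
    (hAk : ∀ k : ℕ, 1 ≤ k → k ≤ 3 → ∀ x, ‖iteratedFDeriv ℝ k A x‖ ≤ C * ((1 + ‖x‖) ^ k)⁻¹) :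
    Jst v * J1 v (curl A) - kStar ^ 2 * M ^ 2 * (Wpa v * A1 v (curl A) + Zen v * C1 v (curl A)) =
      ∫ x, ⟪v x, curl A x⟫_ℝ ∂μ := by
  obtain ⟨han, hcd, hdiv, hMpos, hM, hB, h1, h2, hpos, heq, hcM, hfar, hL6, hfin, hmass, hμ⟩ := h
  haveI := hfin
  exact multiplierIdentity_curl_of_boundedPotential hcd hM h1 h2 μ hμ hA hA0 hAk

/-- The skeleton's `Sig.StubA` (file `Lines/kernel_budget.lean`, verbatim copy — crux workfiles are not importable). -/
def SigStubA : Prop :=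
    ∀ (w : EuclideanSpace ℝ (Fin 3) → EuclideanSpace ℝ (Fin 3)) (c : EuclideanSpace ℝ (Fin 3)) (M : ℝ), AnalyticOnNhd ℝ w Set.univ → ContDiff ℝ (⊤ : ℕ∞) w → Literature.Analysis.FluidPDE.VectorCalculus.IsDivFree w → (∃ B : ℝ, ∀ x, ‖fderiv ℝ w x‖ ≤ B) → (∫⁻ x, ‖iteratedFDeriv ℝ 1 w x‖ₑ ^ 2 < ⊤) → (∫⁻ x, ‖iteratedFDeriv ℝ 2 w x‖ₑ ^ 2 < ⊤) → (∀ x, ‖w x‖ = M) → ‖c‖ = M → Filter.Tendsto (fun x => w x - c) (Filter.cocompact (EuclideanSpace ℝ (Fin 3))) (nhds 0) → 0 < M * Real.sqrt (∫ x, ‖Literature.Analysis.FluidPDE.curl w x‖ ^ 2) * Real.sqrt (∫ x, Literature.Analysis.FluidPDE.frobeniusNormSq (fderiv ℝ (Literature.Analysis.FluidPDE.curl w) x)) → (sInf {κ : ℝ | (∀ (v : EuclideanSpace ℝ (Fin 3) → EuclideanSpace ℝ (Fin 3)) (M B : ℝ), ContDiff ℝ (⊤ : ℕ∞) v → Literature.Analysis.FluidPDE.VectorCalculus.IsDivFree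 v → (∀ x, ‖v x‖ ≤ M) → (∀ x, ‖fderiv ℝ v x‖ ≤ B) → (∫⁻ x, ‖iteratedFDeriv ℝ 0 v x‖ₑ ^ 2 < ⊤) → (∫⁻ x, ‖iteratedFDeriv ℝ 1 v x‖ₑ ^ 2 < ⊤) → (∫⁻ x, ‖iteratedFDeriv ℝ 2 v x‖ₑ ^ 2 < ⊤) → |∫ x, ⟪Literature.Analysis.FluidPDE.curl v x, fderiv ℝ v x (Literature.Analysis.FluidPDE.curl v x)⟫_ℝ| ≤ κ * M * Real.sqrt (∫ x, ‖Literature.Analysis.FluidPDE.curl v x‖ ^ 2) * Real.sqrt (∫ x, Literature.Analysis.FluidPDE.frobeniusNormSq (fderiv ℝ (Literature.Analysis.FluidPDE.curl v) x)))}) * M * Real.sqrt (∫ x, ‖Literature.Analysis.FluidPDE.curl w x‖ ^ 2) * Real.sqrt (∫ x, Literature.Analysis.FluidPDE.frobeniusNormSq (fderiv ℝ (Literature.Analysis.FluidPDE.curl w) x)) = |∫ x, ⟪Literature.Analysis.FluidPDE.curl w x, fderiv ℝ w x (Literature.Analysis.FluidPDE.curl w x)⟫_ℝ| →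
      ((∀ T : ℝ, 0 < T → Integrable (fun x => {x : EuclideanSpace ℝ (Fin 3) | |⟪x, c⟫_ℝ| / ‖c‖ ≤ T}.indicator (fun x => ‖w x - c‖ ^ 2) x) volume) ∧ ∃ E₀ : ℝ, 0 < E₀ ∧ ∀ s : ℝ, (∫ x, deriv Real.smoothTransition (⟪x, c⟫_ℝ / ‖c‖ - s) * ‖w x - c‖ ^ 2) = E₀) →
      (Filter.Tendsto (fun r : ℝ => r⁻¹ * ∫ x in {x : EuclideanSpace ℝ (Fin 3) | r < ‖x‖ ∧ ‖x‖ < 2 * r}, ‖w x - c‖ ^ 2) Filter.atTop (nhds 0))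

/-- **ARROW (PROVED): T8 ⇒ stub A.**  Annular decay for every residue package implies the skeleton's `Sig.StubA` (which carries the extra,
now unused, JET hypothesis): the package is produced by the tree's `exists_multiplierMeasure_farField`, the far field being unique. -/
theorem annularDecay_stubA
    (hT8 : ∀ (v : E3 → E3) (c : E3) (M B : ℝ) (μ : Measure E3), IsResiduePackage v c M B μ →
      Tendsto (fun r : ℝ => r⁻¹ * ∫ x in {x : E3 | r < ‖x‖ ∧ ‖x‖ < 2 * r}, ‖v x - c‖ ^ 2) atTop (𝓝 0)) :
    SigStubA := by
  intro w c M han hcd hdiv hBex h1 h2 hM hcM htend hpos hext _hjet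
  obtain ⟨B, hB⟩ := hBex
  have hM0 : 0 ≤ M := by rw [← hM 0]; exact norm_nonneg _
  have hpos' : 0 < M * Real.sqrt (Zen w) * Real.sqrt (Wpa w) := hpos
  have hMpos : 0 < M := by
    rcases hM0.lt_or_eq with h | h
    · exact h
    · exfalso; rw [← h] at hpos'; simp at hpos'
  have hatt : |Jst w| = kStar * M * Real.sqrt (Zen w) * Real.sqrt (Wpa w) := hext.symm
  obtain ⟨c', μ, hc'M, hdec', hmem, hfin, hmass, -, hμ, -, -⟩ :=
    ExtremiserLiouville.exists_multiplierMeasure_farField hcd hdiv hMpos hM hB h1 h2 hatt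
  -- the far field is unique: `c' = c`
  have hcc : c' = c := by
    have hsub := hdec'.sub htend
    have hfun : (fun x => (w x - c') - (w x - c)) = fun _ => c - c' := by
      funext x; abel
    rw [hfun, sub_zero] at hsub
    haveI : (cocompact E3).NeBot := inferInstance
    have := tendsto_const_nhds_iff.mp hsub
    exact (sub_eq_zero.mp this).symm
  subst hcc
  exact hT8 w c' M B μ ⟨han, hcd, hdiv, hMpos, hM, hB, h1, h2, hpos', hatt, hc'M, htend, hmem, hfin, hmass, hμ⟩

/-- Sanity link (PROVED): T4 is equivalent to the vanishing of the axial force, by the tree identity `∫‖v − c‖²dμ = 2S²` and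
extremality `κ⋆²ZW·M² = S²` — recorded as the implication actually used downstream: mass equality ⇒ `∫⟪v, c⟫ dμ = 0`. -/
theorem integral_inner_farField_eq_zero_of_massEquality (v : E3 → E3) (c : E3) (M B : ℝ) (μ : Measure E3)
    (h : IsResiduePackage v c M B μ) (hmass : μ.real univ = kStar ^ 2 * Zen v * Wpa v) :
    ∫ x, ⟪v x, c⟫_ℝ ∂μ = 0 := by
  obtain ⟨-, hv, hdiv, hMpos, hM, hB, h1, h2, hpos, hatt, hcM, -, hmem, hfin, -, hμ⟩ := h
  haveI := hfin
  have hsq := ExtremiserLiouville.multiplier_integral_normSq_sub hv hdiv hM hB h1 h2 hatt hcM hmem hμ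
  -- pointwise `⟪v, c⟫ = M² − ‖v − c‖²/2`
  have hpt : ∀ x, ⟪v x, c⟫_ℝ = M ^ 2 - ‖v x - c‖ ^ 2 / 2 := fun x => by
    rw [norm_sub_sq_real, hM x, hcM]
    ring
  have hint : Integrable (fun x => ‖v x - c‖ ^ 2) μ := by
    refine Integrable.of_bound (C := (2 * M) ^ 2) ?_ (Eventually.of_forall fun x => ?_)
    · exact ((hv.continuous.sub continuous_const).norm.pow 2).aestronglyMeasurable
    · have hn : ‖v x - c‖ ≤ 2 * M := (norm_sub_le _ _).trans (by rw [hM x, hcM]; linarith)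
      rw [Real.norm_eq_abs, abs_of_nonneg (by positivity)]
      exact pow_le_pow_left₀ (norm_nonneg _) hn 2
  -- extremality: S² = κ⋆² M² Z W
  have hS : Jst v ^ 2 = kStar ^ 2 * M ^ 2 * Zen v * Wpa v := by
    have hZ0 : 0 ≤ Zen v := integral_nonneg fun x => sq_nonneg _
    have hW0 : 0 ≤ Wpa v := integral_nonneg fun x => frobeniusNormSq_nonneg _
    rw [← sq_abs, hatt]
    rw [show (kStar * M * Real.sqrt (Zen v) * Real.sqrt (Wpa v)) ^ 2 =
        kStar ^ 2 * M ^ 2 * (Real.sqrt (Zen v)) ^ 2 * (Real.sqrt (Wpa v)) ^ 2 by ring,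
      Real.sq_sqrt hZ0, Real.sq_sqrt hW0]
  simp_rw [hpt]
  rw [integral_sub (integrable_const _) (hint.div_const 2), integral_const, smul_eq_mul, integral_div, hsq, hmass, hS]
  ring

end Summit.NavierStokesRegularity.NavierStokesRegularity.Cruxes.NearExtremalTransience.KernelBudget.SignLaw

end
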